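import Mathlib.Topology.Instances.AddCircle.Defs
import Literature.Probability.RandomPlanarGeometry.Curve
import Literature.Probability.RandomPlanarGeometry.CurveSpace
import Literature.Probability.RandomPlanarGeometry.LoopEnsembleSpace
import HarnessLib

/-!
# Unbased loops: change of base point and the unbased reparametrisation distance

The prelude's `CurveClass E` identifies curves up to *increasing* reparametrisation of `[0, 1]`,
so a closed curve remembers its base point (`LoopEnsembleSpace`, design note "Base points");
this is also the distance of Camia–Newman (CMP 268 (2006), §2.2, distance (2): curves "modulo
monotonic reparametrizations" of the unit interval, `inf sup_{t ∈ [0,1]} |γ₁(t) - γ₂(t)|`, the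
prelude's `reparamDist`). Duminil-Copin–Kozlowski–Krachun–Manolescu–Oulamara instead measure
loops by the *unbased* distance
`d(γ₁, γ₂) = inf sup_{t ∈ S¹} |γ₁(t) - γ₂(t)|`, "the infimum running over all continuous
one-to-one parametrizations of the loops `γ₁` and `γ₂` by `S¹`" (DKKMO, arXiv:2012.11672v2,
eq. (1)). This file builds the oriented version of that distance on top of the prelude, as the
first step of the passage between the paper's metric `d_CN` and the conventions of
crit-perc.S25 (`Literature.Probability.Percolation.LoopRotationInvariance`):

* `Curve.loopMap γ : AddCircle 1 → E` — a loop as a map of the circle `ℝ/ℤ` (Mathlib's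
  `AddCircle.liftIco`; not to be confused with Mathlib's `circleMap` of complex analysis), continuous when `γ.IsLoop`;
* `Curve.shift γ a` — change of base point, `t ↦ γ (t + a mod 1)` (junk `γ` if `γ` is not a
  loop); `shift_zero`, `shift_shift`, `shift_add_one`, `loopMap_shift`;
* `OrderIso.conjRotate ψ s` — the conjugate `u ↦ ψ(u + s) - ψ(s) (mod 1)` of an increasing
  reparametrisation `ψ` of `[0, 1]` (a based circle homeomorphism) by the rotation by `s`, again an
  increasing reparametrisation; `Curve.reparam_shift`: `(γ ∘ ψ).shift s = (γ.shift (ψ s)) ∘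
  conjRotate ψ s` — every orientation-preserving circle homeomorphism is a rotation followed by a
  based one, so the unbased distance below is DKKMO's infimum restricted to orientation-preserving
  parametrisations;
* `Curve.loopDist α β = ⨅ b, reparamDist α (β.shift b)` — the **unbased oriented
  reparametrisation distance**; it is at most the based distance, invariant under shifting either
  loop (`loopDist_shift_left/right`), symmetric and satisfies the triangle inequality on loops
  (`loopDist_comm`, `loopDist_triangle`), and is compatible with the reparametrisation
  pseudo-metric in both arguments (`loopDist_eq_of_reparamDist_eq_zero(_right)`), hence descends
  to loop classes. The unoriented distance of eq. (1) is `min (loopDist α β) (loopDist α β.reverse)`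
  (with the prelude's `Curve.reverse`); it is not needed here.

## References

* M. Aizenman, A. Burchard, Duke Math. J. 99 (1999), §2.1 (curves modulo reparametrisation).
* F. Camia, C. M. Newman, Comm. Math. Phys. 268 (2006), §2.2, distance (2) (the *based* distance
  of the prelude, for contrast).
* H. Duminil-Copin, K. K. Kozlowski, D. Krachun, I. Manolescu, M. Oulamara, arXiv:2012.11672v2
  (2026), §1.2, eq. (1).
-/

noncomputable section

open Set
open scoped unitInterval

namespace Literature.Probability.RandomPlanarGeometry

/-! ### Conjugating a based reparametrisation by a rotation -/

namespace OrderIso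

variable (ψ : I ≃o I) (s : I)

/-- `u + s` as a point of `[0, 1]` (when `u + s ≤ 1`). [folklore] -/
def addPt (u : I) (h : (u : ℝ) + s ≤ 1) : I := ⟨u + s, by linarith [u.2.1, s.2.1], h⟩

/-- `u + s - 1` as a point of `[0, 1]` (when `u + s > 1`). [folklore] -/
def subPt (u : I) (h : 1 < (u : ℝ) + s) : I := ⟨u + s - 1, by linarith, by linarith [u.2.2, s.2.2]⟩

/-- Coordinates of `addPt`. [folklore] -/
@[simp] theorem coe_addPt (u : I) (h : (u : ℝ) + s ≤ 1) : (addPt s u h : ℝ) = u + s := rfl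

/-- Coordinates of `subPt`. [folklore] -/
@[simp] theorem coe_subPt (u : I) (h : 1 < (u : ℝ) + s) : (subPt s u h : ℝ) = u + s - 1 := rfl

/-- `s ≤ u + s`. [folklore] -/
theorem le_addPt (u : I) (h : (u : ℝ) + s ≤ 1) : s ≤ addPt s u h :=
  show (s : ℝ) ≤ u + s by linarith [u.2.1]

/-- `u + s - 1 ≤ s`. [folklore] -/
theorem subPt_le (u : I) (h : 1 < (u : ℝ) + s) : subPt s u h ≤ s :=
  show (u : ℝ) + s - 1 ≤ s by linarith [u.2.2]

/-- `0 < u + s - 1`. [folklore] -/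
theorem subPt_pos (u : I) (h : 1 < (u : ℝ) + s) : (0 : I) < subPt s u h :=
  show (0 : ℝ) < u + s - 1 by linarith

/-- The conjugate `u ↦ ψ(u + s) - ψ(s) (mod 1)` of `ψ` by the rotation by `s`, as a function
`[0, 1] → [0, 1]`. [folklore] -/
def conjRotateFun (u : I) : I :=
  if h : (u : ℝ) + s ≤ 1 then
    ⟨ψ (addPt s u h) - ψ s, sub_nonneg.2 (ψ.monotone (le_addPt s u h)),
      by linarith [(ψ (addPt s u h)).2.2, (ψ s).2.1]⟩
  else
    ⟨ψ (subPt s u (not_le.1 h)) - ψ s + 1, by linarith [(ψ (subPt s u (not_le.1 h))).2.1, (ψ s).2.2],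
      by
        have : ψ (subPt s u (not_le.1 h)) ≤ ψ s := ψ.monotone (subPt_le s u (not_le.1 h))
        have : ((ψ (subPt s u (not_le.1 h)) : I) : ℝ) ≤ ψ s := this
        linarith⟩

/-- `conjRotateFun` below the wrap-around point. [folklore] -/
theorem conjRotateFun_of_le {u : I} (h : (u : ℝ) + s ≤ 1) :
    (conjRotateFun ψ s u : ℝ) = ψ (addPt s u h) - ψ s := by
  simp [conjRotateFun, h]

/-- `conjRotateFun` above the wrap-around point. [folklore] -/
theorem conjRotateFun_of_lt {u : I} (h : 1 < (u : ℝ) + s) :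
    (conjRotateFun ψ s u : ℝ) = ψ (subPt s u h) - ψ s + 1 := by
  simp [conjRotateFun, not_le.2 h]

/-- Values below the wrap-around point are at most `1 - ψ s`. [folklore] -/
theorem conjRotateFun_le_of_le {u : I} (h : (u : ℝ) + s ≤ 1) :
    (conjRotateFun ψ s u : ℝ) ≤ 1 - ψ s := by
  rw [conjRotateFun_of_le ψ s h]
  linarith [(ψ (addPt s u h)).2.2]

/-- Values above the wrap-around point exceed `1 - ψ s`. [folklore] -/
theorem lt_conjRotateFun_of_lt {u : I} (h : 1 < (u : ℝ) + s) :
    1 - ψ s < (conjRotateFun ψ s u : ℝ) := by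
  rw [conjRotateFun_of_lt ψ s h]
  have : (0 : I) < ψ (subPt s u h) := by
    rw [← show ψ 0 = 0 from OrderIso.map_bot ψ]; exact ψ.strictMono (subPt_pos s u h)
  have : (0 : ℝ) < ψ (subPt s u h) := this
  linarith

/-- `conjRotateFun ψ s` is strictly increasing. [folklore] -/
theorem strictMono_conjRotateFun : StrictMono (conjRotateFun ψ s) := by
  intro u v huv
  have huv' : (u : ℝ) < v := huv
  show (conjRotateFun ψ s u : ℝ) < conjRotateFun ψ s v
  by_cases hu : (u : ℝ) + s ≤ 1 <;> by_cases hv : (v : ℝ) + s ≤ 1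
  · rw [conjRotateFun_of_le ψ s hu, conjRotateFun_of_le ψ s hv]
    have : ψ (addPt s u hu) < ψ (addPt s v hv) :=
      ψ.strictMono (show (u : ℝ) + s < v + s by linarith)
    have : ((ψ (addPt s u hu) : I) : ℝ) < ψ (addPt s v hv) := this
    linarith
  · exact (conjRotateFun_le_of_le ψ s hu).trans_lt (lt_conjRotateFun_of_lt ψ s (not_le.1 hv))
  · exfalso; linarith [not_le.1 hu]
  · rw [conjRotateFun_of_lt ψ s (not_le.1 hu), conjRotateFun_of_lt ψ s (not_le.1 hv)]
    have : ψ (subPt s u (not_le.1 hu)) < ψ (subPt s v (not_le.1 hv)) :=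
      ψ.strictMono (show (u : ℝ) + s - 1 < v + s - 1 by linarith)
    have : ((ψ (subPt s u (not_le.1 hu)) : I) : ℝ) < ψ (subPt s v (not_le.1 hv)) := this
    linarith

/-- `conjRotateFun ψ s` is onto. [folklore] -/
theorem surjective_conjRotateFun : Function.Surjective (conjRotateFun ψ s) := by
  intro v
  by_cases hv : (v : ℝ) ≤ 1 - ψ s
  · -- `v + ψ s ∈ [ψ s, 1] = ψ '' [s, 1]`
    obtain ⟨w, hw⟩ := ψ.surjective ⟨v + ψ s, by linarith [v.2.1, (ψ s).2.1], by linarith⟩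
    have hsw : s ≤ w := by
      have : ψ s ≤ ψ w := by rw [hw]; show ((ψ s : I) : ℝ) ≤ v + ψ s; linarith [v.2.1]
      exact ψ.le_iff_le.1 this
    have hsw' : (s : ℝ) ≤ w := hsw
    have hws1 : (w : ℝ) - s + s ≤ 1 := by linarith [w.2.2]
    refine ⟨⟨w - s, sub_nonneg.2 hsw', by linarith [w.2.2, s.2.1]⟩, Subtype.ext ?_⟩
    rw [conjRotateFun_of_le ψ s hws1]
    have e : addPt s ⟨(w : ℝ) - s, sub_nonneg.2 hsw', by linarith [w.2.2, s.2.1]⟩ hws1 = w :=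
      Subtype.ext (by simp)
    rw [e, hw]
    simp
  · -- `v + ψ s - 1 ∈ (0, ψ s] = ψ '' (0, s]`
    obtain ⟨w, hw⟩ := ψ.surjective
      ⟨v + ψ s - 1, by linarith [not_le.1 hv], by linarith [v.2.2, (ψ s).2.2]⟩
    have hws : w ≤ s := by
      have : ψ w ≤ ψ s := by rw [hw]; show (v : ℝ) + ψ s - 1 ≤ ψ s; linarith [v.2.2]
      exact ψ.le_iff_le.1 this
    have hw0 : (0 : ℝ) < w := by
      have : (0 : I) < ψ w := by rw [hw]; show (0 : ℝ) < v + ψ s - 1; linarith [not_le.1 hv]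
      rw [← show ψ 0 = 0 from OrderIso.map_bot ψ] at this
      exact ψ.lt_iff_lt.1 this
    have hws' : (w : ℝ) ≤ s := hws
    have h1 : (1 : ℝ) < w + 1 - s + s := by linarith
    refine ⟨⟨w + 1 - s, by linarith [s.2.2], by linarith⟩, Subtype.ext ?_⟩
    rw [conjRotateFun_of_lt ψ s h1]
    have e : subPt s ⟨(w : ℝ) + 1 - s, by linarith [s.2.2], by linarith⟩ h1 = w :=
      Subtype.ext (by simp only [coe_subPt]; ring)
    rw [e, hw]
    simp only
    ring

/-- **Conjugation of a based reparametrisation by a rotation.** For an increasing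
reparametrisation `ψ` of `[0, 1]` (a homeomorphism of the circle `ℝ/ℤ` fixing `0`) and a shift
`s`, the map `u ↦ ψ(u + s) - ψ(s) (mod 1)` is again an increasing reparametrisation of `[0, 1]`:
an orientation-preserving circle homeomorphism `h` factors as the rotation by `h(0)` followed by a
based one. (Standard.) [folklore] -/
def conjRotate : I ≃o I :=
  StrictMono.orderIsoOfSurjective _ (strictMono_conjRotateFun ψ s) (surjective_conjRotateFun ψ s)

/-- `conjRotate` below the wrap-around point. [folklore] -/
theorem coe_conjRotate_of_le {u : I} (h : (u : ℝ) + s ≤ 1) :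
    (conjRotate ψ s u : ℝ) = ψ (addPt s u h) - ψ s :=
  conjRotateFun_of_le ψ s h

/-- `conjRotate` above the wrap-around point. [folklore] -/
theorem coe_conjRotate_of_lt {u : I} (h : 1 < (u : ℝ) + s) :
    (conjRotate ψ s u : ℝ) = ψ (subPt s u h) - ψ s + 1 :=
  conjRotateFun_of_lt ψ s h

/-- The defining congruence of `conjRotate`: `conjRotate ψ s u + ψ s ≡ ψ (u + s mod 1) (mod 1)`
(for `s < 1`), as an equality of fractional parts. [folklore] -/
theorem fract_conjRotate_add (hs : (s : ℝ) < 1) (u : I) :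
    Int.fract ((conjRotate ψ s u : ℝ) + ψ s) =
      Int.fract ((ψ ⟨Int.fract ((u : ℝ) + s), Int.fract_nonneg _, (Int.fract_lt_one _).le⟩ : ℝ)) := by
  by_cases h : (u : ℝ) + s ≤ 1
  · rw [coe_conjRotate_of_le ψ s h, sub_add_cancel]
    rcases h.eq_or_lt with h1 | h1
    · -- `u + s = 1`: both sides are `0`
      have ha : addPt s u h = 1 := Subtype.ext h1
      rw [ha, show ψ 1 = 1 from OrderIso.map_top ψ]
      have : Int.fract ((u : ℝ) + s) = 0 := by rw [h1]; exact Int.fract_one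
      simp only [this, Set.Icc.coe_one, Int.fract_one]
      have h0 : (⟨(0 : ℝ), le_rfl, zero_le_one⟩ : I) = 0 := rfl
      simp [h0, show ψ 0 = 0 from OrderIso.map_bot ψ]
    · have e : addPt s u h = ⟨Int.fract ((u : ℝ) + s), Int.fract_nonneg _, (Int.fract_lt_one _).le⟩ :=
        Subtype.ext (Int.fract_eq_self.2 ⟨by linarith [u.2.1, s.2.1], h1⟩).symm
      rw [e]
  · rw [coe_conjRotate_of_lt ψ s (not_le.1 h), show (ψ (subPt s u (not_le.1 h)) : ℝ) - ψ s + 1 + ψ s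
      = ψ (subPt s u (not_le.1 h)) + 1 by ring, Int.fract_add_one]
    have hf : Int.fract ((u : ℝ) + s) = u + s - 1 := by
      rw [Int.fract_eq_iff]
      refine ⟨by linarith [not_le.1 h], by linarith [u.2.2], ⟨1, ?_⟩⟩
      push_cast; ring
    have e : subPt s u (not_le.1 h) =
        ⟨Int.fract ((u : ℝ) + s), Int.fract_nonneg _, (Int.fract_lt_one _).le⟩ :=
      Subtype.ext (by rw [coe_subPt]; exact hf.symm)
    rw [e]

end OrderIso

namespace Curve

/-! ### Loops as circle maps and the change of base point -/

section Topological

variable {E : Type*} [TopologicalSpace E]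

/-- The `1`-periodic circle map of a curve: the map `ℝ/ℤ → E` agreeing with `γ` on `[0, 1)`
(Mathlib's `AddCircle.liftIco`). Continuous when `γ` is a loop (`continuous_loopMap`).
(DKKMO, arXiv:2012.11672v2, eq. (1): "parametrizations of the loops by `S¹`".) [cite: arXiv201211672v2, eq. (1)] -/
def loopMap (γ : Curve E) : AddCircle (1 : ℝ) → E :=
  AddCircle.liftIco 1 0 (Set.IccExtend zero_le_one γ)

/-- The circle map of a loop is continuous. [folklore] -/
theorem continuous_loopMap {γ : Curve E} (hγ : γ.IsLoop) : Continuous γ.loopMap := by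
  refine AddCircle.liftIco_zero_continuous ?_ ?_
  · rw [Set.IccExtend_of_mem _ _ (left_mem_Icc.2 zero_le_one),
      Set.IccExtend_of_mem _ _ (right_mem_Icc.2 zero_le_one)]
    exact hγ
  · exact (γ.continuous.Icc_extend' ).continuousOn

/-- The circle map on representatives in `[0, 1)`. [folklore] -/
theorem loopMap_coe {γ : Curve E} {x : ℝ} (hx : x ∈ Ico (0 : ℝ) 1) :
    γ.loopMap (x : AddCircle (1 : ℝ)) = γ ⟨x, hx.1, hx.2.le⟩ := by
  rw [loopMap, AddCircle.liftIco_coe_apply (by simpa using hx), Set.IccExtend_of_mem]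

/-- The circle map at the class of any real number is the value at its fractional part. [folklore] -/
theorem loopMap_coe_eq (γ : Curve E) (z : ℝ) :
    γ.loopMap (z : AddCircle (1 : ℝ)) =
      γ ⟨Int.fract z, Int.fract_nonneg z, (Int.fract_lt_one z).le⟩ := by
  have h : ((z : ℝ) : AddCircle (1 : ℝ)) = ((Int.fract z : ℝ) : AddCircle (1 : ℝ)) := by
    rw [eq_comm, ← sub_eq_zero, ← AddCircle.coe_sub, AddCircle.coe_eq_zero_iff]
    exact ⟨-⌊z⌋, by rw [zsmul_eq_mul, mul_one, Int.cast_neg, ← Int.self_sub_floor]; ring⟩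
  rw [h, loopMap_coe ⟨Int.fract_nonneg z, Int.fract_lt_one z⟩]

/-- For a loop, points of `[0, 1]` with the same fractional part have the same image
(only `0` and `1` are identified). [folklore] -/
theorem apply_eq_of_fract_eq {γ : Curve E} (hγ : γ.IsLoop) {x y : I}
    (h : Int.fract (x : ℝ) = Int.fract (y : ℝ)) : γ x = γ y := by
  have key : ∀ z : I, γ z = γ ⟨Int.fract (z : ℝ), Int.fract_nonneg _, (Int.fract_lt_one _).le⟩ := by
    intro z
    rcases lt_or_eq_of_le z.2.2 with hz | hz
    · congr 1; exact Subtype.ext (Int.fract_eq_self.2 ⟨z.2.1, hz⟩).symm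
    · have h1 : z = 1 := Subtype.ext hz
      subst h1
      have h0 : (⟨Int.fract ((1 : I) : ℝ), Int.fract_nonneg _, (Int.fract_lt_one _).le⟩ : I) = 0 :=
        Subtype.ext (by simp)
      rw [h0]; exact hγ.symm
  rw [key x, key y]
  congr 2

open Classical in
/-- **Change of base point.** For a loop `γ` and `a : ℝ`, the loop `γ` started at time `a`:
`t ↦ γ (t + a mod 1)`, i.e. `γ.loopMap (t + a)`. For a curve that is not a loop the junk value
is `γ` itself. (DKKMO, arXiv:2012.11672v2, eq. (1): loops are compared up to reparametrisation
of the circle.) [cite: arXiv201211672v2, eq. (1)] -/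
def shift (γ : Curve E) (a : ℝ) : Curve E :=
  if hγ : γ.IsLoop then
    ⟨⟨fun t : I => γ.loopMap (((t : ℝ) + a : ℝ) : AddCircle (1 : ℝ)),
      (continuous_loopMap hγ).comp (by fun_prop)⟩⟩
  else γ

/-- Pointwise formula for `shift` (loops). [folklore] -/
theorem shift_apply {γ : Curve E} (hγ : γ.IsLoop) (a : ℝ) (t : I) :
    γ.shift a t = γ.loopMap (((t : ℝ) + a : ℝ) : AddCircle (1 : ℝ)) := by
  rw [shift, dif_pos hγ]; rfl

/-- `shift` on a non-loop is the junk value `γ`. [folklore] -/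
theorem shift_of_not_isLoop {γ : Curve E} (hγ : ¬ γ.IsLoop) (a : ℝ) : γ.shift a = γ := by
  rw [shift, dif_neg hγ]

/-- A shifted loop is a loop. [folklore] -/
theorem isLoop_shift {γ : Curve E} (hγ : γ.IsLoop) (a : ℝ) : (γ.shift a).IsLoop := by
  rw [Curve.isLoop_iff, Curve.source_def, Curve.target_def, shift_apply hγ, shift_apply hγ]
  congr 1
  simp only [Set.Icc.coe_zero, Set.Icc.coe_one, zero_add]
  rw [AddCircle.coe_add, AddCircle.coe_period, zero_add]

/-- `shift` preserves being a loop, unconditionally. [folklore] -/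
theorem isLoop_shift_iff (γ : Curve E) (a : ℝ) : (γ.shift a).IsLoop ↔ γ.IsLoop := by
  by_cases hγ : γ.IsLoop
  · exact ⟨fun _ => hγ, fun h => isLoop_shift h a⟩
  · rw [shift_of_not_isLoop hγ]

/-- The circle map of a shifted loop is the rotated circle map. [folklore] -/
theorem loopMap_shift {γ : Curve E} (hγ : γ.IsLoop) (a : ℝ) (x : AddCircle (1 : ℝ)) :
    (γ.shift a).loopMap x = γ.loopMap (x + (a : AddCircle (1 : ℝ))) := by
  induction x using QuotientAddGroup.induction_on with
  | H z =>
    change (γ.shift a).loopMap (z : AddCircle (1 : ℝ)) = γ.loopMap ((z : AddCircle (1 : ℝ)) + a)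
    rw [loopMap_coe_eq, shift_apply hγ, ← AddCircle.coe_add, loopMap_coe_eq, loopMap_coe_eq]
    congr 2
    have hf : Int.fract z + a - (z + a) = ((-⌊z⌋ : ℤ) : ℝ) := by
      rw [Int.cast_neg, ← Int.self_sub_floor]; ring
    exact Int.fract_eq_fract.2 ⟨-⌊z⌋, hf⟩

/-- Shifting by `0` does nothing. [folklore] -/
@[simp] theorem shift_zero (γ : Curve E) : γ.shift 0 = γ := by
  by_cases hγ : γ.IsLoop
  · apply DFunLike.coe_injective
    funext t
    rw [shift_apply hγ, add_zero, loopMap_coe_eq]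
    rcases lt_or_eq_of_le t.2.2 with h | h
    · congr 1; exact Subtype.ext (Int.fract_eq_self.2 ⟨t.2.1, h⟩)
    · obtain rfl : t = 1 := Subtype.ext h
      have h0 : (⟨Int.fract ((1 : I) : ℝ), Int.fract_nonneg _, (Int.fract_lt_one _).le⟩ : I) = 0 :=
        Subtype.ext (by simp)
      rw [h0]
      exact hγ
  · exact shift_of_not_isLoop hγ 0

/-- Shifts compose additively. [folklore] -/
theorem shift_shift (γ : Curve E) (a b : ℝ) : (γ.shift a).shift b = γ.shift (a + b) := by
  by_cases hγ : γ.IsLoop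
  · apply DFunLike.coe_injective
    funext t
    rw [shift_apply (isLoop_shift hγ a), shift_apply hγ, loopMap_shift hγ, ← AddCircle.coe_add]
    congr 2
    ring
  · rw [shift_of_not_isLoop hγ, shift_of_not_isLoop hγ, shift_of_not_isLoop hγ]

/-- Shifts only depend on the shift modulo `1`. [folklore] -/
theorem shift_add_one (γ : Curve E) (a : ℝ) : γ.shift (a + 1) = γ.shift a := by
  by_cases hγ : γ.IsLoop
  · apply DFunLike.coe_injective
    funext t
    rw [shift_apply hγ, shift_apply hγ, ← add_assoc, AddCircle.coe_add, AddCircle.coe_period,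
      add_zero]
  · rw [shift_of_not_isLoop hγ, shift_of_not_isLoop hγ]

/-- A shift by any real amount is a shift by a point of `[0, 1)`. [folklore] -/
theorem shift_eq_shift_fract (γ : Curve E) (b : ℝ) :
    γ.shift b = γ.shift (⟨Int.fract b, Int.fract_nonneg _, (Int.fract_lt_one _).le⟩ : I) := by
  by_cases hγ : γ.IsLoop
  · apply DFunLike.coe_injective
    funext t
    rw [shift_apply hγ, shift_apply hγ]
    congr 1
    rw [AddCircle.coe_add, AddCircle.coe_add]
    congr 1
    simp only
    rw [eq_comm, ← sub_eq_zero, ← AddCircle.coe_sub, AddCircle.coe_eq_zero_iff]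
    exact ⟨-⌊b⌋, by rw [zsmul_eq_mul, mul_one, Int.cast_neg, ← Int.self_sub_floor]; ring⟩
  · rw [shift_of_not_isLoop hγ, shift_of_not_isLoop hγ]

/-- A reparametrised loop is a loop. [folklore] -/
theorem isLoop_reparam {γ : Curve E} (hγ : γ.IsLoop) (ψ : I ≃o I) : (γ.reparam ψ).IsLoop := by
  rw [Curve.isLoop_iff, Curve.source_def, Curve.target_def, reparam_apply, reparam_apply,
    show ψ 0 = 0 from OrderIso.map_bot ψ, show ψ 1 = 1 from OrderIso.map_top ψ]
  exact hγ

/-- **Change of base point after a based reparametrisation**: for a loop `γ`, shifting the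
reparametrised loop `γ ∘ ψ` by `s` gives the loop `γ` shifted by `ψ s`, reparametrised by the
conjugate `conjRotate ψ s`. This is why the infimum over base points and based reparametrisations
(`loopDist`) is an infimum over all orientation-preserving parametrisations of the circle.
(DKKMO, arXiv:2012.11672v2, eq. (1).) [folklore] -/
theorem reparam_shift {γ : Curve E} (hγ : γ.IsLoop) (ψ : I ≃o I) {s : I} (hs : (s : ℝ) < 1) :
    (γ.reparam ψ).shift s = (γ.shift (ψ s)).reparam (OrderIso.conjRotate ψ s) := by
  apply DFunLike.coe_injective
  funext t
  rw [shift_apply (isLoop_reparam hγ ψ), loopMap_coe_eq, reparam_apply, reparam_apply,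
    shift_apply hγ, loopMap_coe_eq]
  apply apply_eq_of_fract_eq hγ
  rw [Int.fract_fract]
  exact (OrderIso.fract_conjRotate_add ψ s hs t).symm

end Topological

/-! ### The unbased oriented reparametrisation distance -/

section Metric

variable {E : Type*} [PseudoMetricSpace E]

/-- Shifting both loops by the same amount preserves the sup distance. [folklore] -/
theorem dist_toContinuousMap_shift_shift {α β : Curve E} (hα : α.IsLoop) (hβ : β.IsLoop) (a : ℝ) :
    dist (α.shift a).toContinuousMap (β.shift a).toContinuousMap =
      dist α.toContinuousMap β.toContinuousMap := by
  refine le_antisymm ?_ ?_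
  · refine (ContinuousMap.dist_le dist_nonneg).2 fun t ↦ ?_
    change dist (α.shift a t) (β.shift a t) ≤ _
    rw [shift_apply hα, shift_apply hβ, loopMap_coe_eq, loopMap_coe_eq]
    exact ContinuousMap.dist_apply_le_dist (f := α.toContinuousMap) (g := β.toContinuousMap) _
  · refine (ContinuousMap.dist_le dist_nonneg).2 fun t ↦ ?_
    change dist (α t) (β t) ≤ _
    set t' : I := ⟨Int.fract ((t : ℝ) - a), Int.fract_nonneg _, (Int.fract_lt_one _).le⟩
    have hf : Int.fract ((t' : ℝ) + a) = Int.fract (t : ℝ) := by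
      simp only [t']
      rw [Int.fract_eq_fract]
      refine ⟨-⌊(t : ℝ) - a⌋, ?_⟩
      rw [Int.cast_neg, ← Int.self_sub_floor]
      ring
    have eα : α t = α.shift a t' := by
      rw [shift_apply hα, loopMap_coe_eq]
      exact apply_eq_of_fract_eq hα (by rw [Int.fract_fract, hf])
    have eβ : β t = β.shift a t' := by
      rw [shift_apply hβ, loopMap_coe_eq]
      exact apply_eq_of_fract_eq hβ (by rw [Int.fract_fract, hf])
    rw [eα, eβ]
    exact ContinuousMap.dist_apply_le_dist (f := (α.shift a).toContinuousMap)
      (g := (β.shift a).toContinuousMap) _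

/-- The **unbased oriented reparametrisation distance** from `α` to the loop `β`: the infimum,
over changes of base point of `β`, of the based reparametrisation distance
`reparamDist α (β.shift b)`; equivalently (`reparam_shift`) the infimum of
`sup_t dist (α t) (β (h t))` over orientation-preserving homeomorphisms `h` of the circle —
DKKMO's `d(γ₁, γ₂)` of eq. (1) restricted to orientation-preserving parametrisations.
(DKKMO, arXiv:2012.11672v2, eq. (1).) [cite: arXiv201211672v2, eq. (1)] -/
def loopDist (α β : Curve E) : ℝ :=
  ⨅ b : I, reparamDist α (β.shift b)

/-- `loopDist` is at most each of the based distances it is the infimum of. [folklore] -/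
theorem loopDist_le (α β : Curve E) (b : I) : loopDist α β ≤ reparamDist α (β.shift b) :=
  ciInf_le ⟨0, by rintro _ ⟨b, rfl⟩; exact reparamDist_nonneg _ _⟩ b

/-- `loopDist α β ≤ reparamDist α (β.shift b)` for every real shift. [folklore] -/
theorem loopDist_le' (α β : Curve E) (b : ℝ) : loopDist α β ≤ reparamDist α (β.shift b) := by
  rw [shift_eq_shift_fract β b]; exact loopDist_le α β _

/-- The unbased distance is at most the based one. [cite: arXiv201211672v2, eq. (1)] -/
theorem loopDist_le_reparamDist (α β : Curve E) : loopDist α β ≤ reparamDist α β := by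
  simpa using loopDist_le' α β 0

/-- `loopDist` is nonnegative. [folklore] -/
theorem loopDist_nonneg (α β : Curve E) : 0 ≤ loopDist α β :=
  le_ciInf fun _ ↦ reparamDist_nonneg _ _

/-- `loopDist α α = 0`. [folklore] -/
theorem loopDist_self (α : Curve E) : loopDist α α = 0 :=
  le_antisymm (by simpa [reparamDist_self] using loopDist_le_reparamDist α α) (loopDist_nonneg α α)

/-- **Lemma.** Shifting the first loop does not increase the unbased distance to any shift of the
second: `loopDist (α.shift a) β ≤ reparamDist α (β.shift b)`. [folklore] -/
theorem loopDist_shift_le {α β : Curve E} (hα : α.IsLoop) (hβ : β.IsLoop) (a : I) (b : ℝ) :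
    loopDist (α.shift a) β ≤ reparamDist α (β.shift b) := by
  refine le_ciInf fun ψ ↦ ?_
  rcases lt_or_eq_of_le a.2.2 with ha | ha
  · have key := reparam_shift (isLoop_shift hβ b) ψ (s := a) ha
    calc loopDist (α.shift a) β
        ≤ reparamDist (α.shift a) (β.shift (b + ψ a)) := loopDist_le' _ _ _
      _ ≤ dist (α.shift a).toContinuousMap
            (((β.shift (b + ψ a))).reparam (OrderIso.conjRotate ψ a)).toContinuousMap :=
          reparamDist_le _ _ _
      _ = dist (α.shift a).toContinuousMap (((β.shift b).reparam ψ).shift a).toContinuousMap := by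
          rw [key, shift_shift]
      _ = dist α.toContinuousMap ((β.shift b).reparam ψ).toContinuousMap :=
          dist_toContinuousMap_shift_shift hα (isLoop_reparam (isLoop_shift hβ b) ψ) _
  · have h1 : α.shift a = α := by
      rw [show ((a : I) : ℝ) = 0 + 1 by rw [ha]; ring, shift_add_one, shift_zero]
    rw [h1]
    exact (loopDist_le' α β b).trans (reparamDist_le _ _ ψ)

/-- `loopDist` is invariant under shifting the second loop. [folklore] -/
theorem loopDist_shift_right (α β : Curve E) (b : ℝ) : loopDist α (β.shift b) = loopDist α β := by
  refine le_antisymm (le_ciInf fun c ↦ ?_) (le_ciInf fun c ↦ ?_)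
  · have : β.shift c = (β.shift b).shift ((c : ℝ) - b) := by rw [shift_shift]; congr 1; ring
    rw [this]
    exact loopDist_le' _ _ _
  · rw [shift_shift]
    exact loopDist_le' _ _ _

/-- `loopDist` does not increase under shifting the first loop. [folklore] -/
theorem loopDist_shift_left_le {α β : Curve E} (hα : α.IsLoop) (hβ : β.IsLoop) (a : ℝ) :
    loopDist (α.shift a) β ≤ loopDist α β := by
  rw [shift_eq_shift_fract α a]
  exact le_ciInf fun b ↦ loopDist_shift_le hα hβ _ _

/-- `loopDist` is invariant under shifting the first loop. [folklore] -/
theorem loopDist_shift_left {α β : Curve E} (hα : α.IsLoop) (hβ : β.IsLoop) (a : ℝ) :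
    loopDist (α.shift a) β = loopDist α β := by
  refine le_antisymm (loopDist_shift_left_le hα hβ a) ?_
  have h := loopDist_shift_left_le (isLoop_shift hα a) hβ (-a)
  rwa [shift_shift, add_neg_cancel, shift_zero] at h

/-- **Symmetry** of `loopDist` on loops. [cite: arXiv201211672v2, eq. (1)] -/
theorem loopDist_comm {α β : Curve E} (hα : α.IsLoop) (hβ : β.IsLoop) :
    loopDist α β = loopDist β α := by
  suffices key : ∀ {α β : Curve E}, α.IsLoop → β.IsLoop → loopDist β α ≤ loopDist α β from
    le_antisymm (key hβ hα) (key hα hβ)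
  intro α β hα hβ
  refine le_ciInf fun b ↦ ?_
  calc loopDist β α = loopDist (β.shift b) α := (loopDist_shift_left hβ hα _).symm
    _ ≤ reparamDist (β.shift b) (α.shift (0 : ℝ)) := loopDist_le' _ _ _
    _ = reparamDist α (β.shift b) := by rw [shift_zero, reparamDist_comm]

/-- **Triangle inequality** for `loopDist` (middle and last curves loops). [cite: arXiv201211672v2, eq. (1)] -/
theorem loopDist_triangle (α : Curve E) {β γ : Curve E} (hβ : β.IsLoop) (hγ : γ.IsLoop) :
    loopDist α γ ≤ loopDist α β + loopDist β γ := by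
  have key : ∀ b : I, loopDist α γ - loopDist β γ ≤ reparamDist α (β.shift b) := by
    intro b
    rw [sub_le_iff_le_add, ← loopDist_shift_left hβ hγ b]
    have h : ∀ c : I, loopDist α γ - reparamDist α (β.shift b) ≤
        reparamDist (β.shift b) (γ.shift c) := by
      intro c
      have := reparamDist_triangle α (β.shift b) (γ.shift c)
      linarith [loopDist_le α γ c]
    have h' := le_ciInf h
    change loopDist α γ - reparamDist α (β.shift b) ≤ loopDist (β.shift b) γ at h'
    linarith
  have h := le_ciInf key
  change loopDist α γ - loopDist β γ ≤ loopDist α β at h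
  linarith

/-- `reparamDist` is invariant under reparametrising the second curve. [folklore] -/
theorem reparamDist_reparam_right (α γ : Curve E) (χ : I ≃o I) :
    reparamDist α (γ.reparam χ) = reparamDist α γ := by
  refine le_antisymm (le_ciInf fun ψ ↦ ?_) (le_ciInf fun ψ ↦ ?_)
  · have h := reparamDist_le α (γ.reparam χ) (ψ.trans χ.symm)
    rw [reparam_reparam, OrderIso.trans_assoc, OrderIso.symm_trans_self, OrderIso.trans_refl] at h
    exact h
  · have h := reparamDist_le α γ (ψ.trans χ)
    rwa [← reparam_reparam] at h

/-- `loopDist` is compatible with the reparametrisation pseudo-metric in the first argument.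
[folklore] -/
theorem loopDist_eq_of_reparamDist_eq_zero {α α' : Curve E} (β : Curve E)
    (h : reparamDist α α' = 0) : loopDist α β = loopDist α' β := by
  have key : ∀ {α α' : Curve E}, reparamDist α α' = 0 → loopDist α' β ≤ loopDist α β := by
    intro α α' h
    refine le_ciInf fun b ↦ ?_
    have := reparamDist_triangle α' α (β.shift b)
    rw [reparamDist_comm α' α, h, zero_add] at this
    exact (loopDist_le α' β b).trans this
  exact le_antisymm (key (by rwa [reparamDist_comm])) (key h)

/-- `loopDist` is compatible with the reparametrisation pseudo-metric in the second (loop)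
argument: if `β' = lim β ∘ φₙ` uniformly then, by `reparam_shift`, every shift of `β'` is a uniform
limit of based reparametrisations of shifts of `β`. [folklore] -/
theorem loopDist_eq_of_reparamDist_eq_zero_right (α : Curve E) {β β' : Curve E} (hβ : β.IsLoop)
    (hβ' : β'.IsLoop) (h : reparamDist β β' = 0) : loopDist α β = loopDist α β' := by
  have key : ∀ {β β' : Curve E}, β.IsLoop → β'.IsLoop → reparamDist β β' = 0 →
      loopDist α β' ≤ loopDist α β := by
    intro β β' hβ hβ' h
    refine le_ciInf fun b ↦ le_of_forall_pos_le_add fun ε hε ↦ ?_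
    -- WLOG `b < 1`
    wlog hb : (b : ℝ) < 1 generalizing b
    · have hb1 : (b : ℝ) = 1 := le_antisymm b.2.2 (not_lt.1 hb)
      have e : β.shift b = β.shift (0 : I) := by
        rw [show ((b : I) : ℝ) = ((0 : I) : ℝ) + 1 by rw [hb1]; simp, shift_add_one]
      rw [e]
      exact this (0 : I) (by simp)
    have hd : dist β' β < ε := by rwa [Curve.dist_def, reparamDist_comm, h]
    obtain ⟨φ, hφ⟩ := exists_dist_reparam_lt hd
    set b'' : I := φ.symm b with hb''
    have hφb : φ b'' = b := φ.apply_symm_apply b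
    have hb''1 : (b'' : ℝ) < 1 := by
      have : b'' < 1 := by
        rw [← φ.lt_iff_lt, hφb, show φ 1 = 1 from OrderIso.map_top φ]
        exact hb
      exact this
    have hshift := reparam_shift hβ φ (s := b'') hb''1
    rw [hφb] at hshift
    calc loopDist α β'
        ≤ reparamDist α (β'.shift b'') := loopDist_le α β' b''
      _ ≤ reparamDist α ((β.reparam φ).shift b'') +
            reparamDist ((β.reparam φ).shift b'') (β'.shift b'') := reparamDist_triangle _ _ _
      _ ≤ reparamDist α (β.shift b) + ε := by
          refine add_le_add ?_ ?_
          · rw [hshift, reparamDist_reparam_right]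
          · refine (reparamDist_le_dist _ _).trans ?_
            rw [dist_toContinuousMap_shift_shift (isLoop_reparam hβ φ) hβ', dist_comm]
            exact hφ.le
  exact le_antisymm (key hβ' hβ (by rwa [reparamDist_comm])) (key hβ hβ' h)

end Metric

end Curve

end Literature.Probability.RandomPlanarGeometry

end
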